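import Summits.QuantumFields.YangMills.Theorems.BalabanUVNodesK0TopIndexWrapGeometry
import Summits.QuantumFields.YangMills.Theorems.BalabanUVNodesK0ConstantDirectionTower
import Literature.MathematicalPhysics.QuantumFieldTheory.Balaban1983to89.Node00.Record12BgRowCoClassGauge
import Literature.MathematicalPhysics.QuantumFieldTheory.Balaban1983to89.Node00.CriticalOnFibreGauge

/-!
# K0⁶ ROW P11 — THE CHEAP FLOORS `0 < B₃'` ∕ `0 < B₉` OF THE GUARDED ∃-GAUGE SENTENCES: node00-def-P11's `VariationalThm1GaugeRegSep{Top7M,CoP7M}` (FILE 14 v1.1, p534358) and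
# dag-n07-e's step sentences `Gauge9RegSepTopStep` ∕ `Gauge152OfClassTopStep` (`Node00/CriticalOnFibreGauge.lean`, p532575)

Cell `pub-ymgap`, seat `pub-ymgap-dag-n21-c` g10 (R134 (a) N21 NE7c s1; K0 ROW P11 negative lane of record; INBOX INTENT-1 l.20027 §5, dag-lead DEDUP-294 GO).
Filed `--kind proof --supports stmt-QuantumFields-20506 --as helper` (K0⁶ `Record13SepCoPRInhabited`).  Companion of `…K0VariationalThm1GaugeWrap` (the tightness of the non-wrapping premise).
[15] = [Balaban1985Variational], [I] = [Balaban1987RG1], [III] = [Balaban1988Convergent], [6] = [Balaban1985RegularSpaces].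

WHAT THIS FILE PROVES (theorems only; no `def`).  node00-def-P11's «expected floor `0 < B₃'`» (FILE 14 §1 docstring; INBOX l.19952 (β), l.20023) and dag-n07-e's «expected floors
`0 < B₃'` (Gauge9), `0 < B₉` (Gauge152)» (RANGE NOTE, INBOX l.19920) made kernel, by ONE flat instance:
* `side_one_lt_sitesPerDir` — on `F.P M` the `LM`-cube of step `1` does not wrap (`L·M < L^{M+1} ≤ L^{m+M} < 2L^{m+M}`), so the guarded sentences DO read it.
* ★ `flat_top_instance` — at the TOP index of length `1` (`Ω₁ = T_η`, companion `exists_seq_top`) on `F.P K`, the flat configuration `U₀ ≡ 1` (a constant-direction field with `D = 1`,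
  FILE 24A) with its own flat tower as datum meets every antecedent clause at constant thresholds `δ′ = min(a₁, a₀∕max(B₃,1))`, `ε₀ = a₀` (every plaquette variable read is `1`; class
  clauses `0 < a₀η_m²`, `0 < a₀η_m³`; minimiser over the top-domain class (6) — FILE 21A `mem_classTop_of_forall_dist1_lt`, action `0`), and the `LM`-cube of index `0` lies in `Ω₁` and
  holds the bond `⟨π(0), e₀⟩`.
* ★ `pos_of_gauge9RegSepTopStep` ∕ `not_gauge9RegSepTopStep_of_nonpos` — `Gauge9RegSepTopStep F N Sup M B₃ B₃' a₀ a₁ → 0 < B₃'` (`M ≥ 1`, `0 < a₀`, `0 < a₁`): the handed-over `A` has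
  `0 ≤ ‖A(⟨π(0), e₀⟩)‖ < B₃'δ′` (through dag-n07-e's `gauge9_of_isMinimizer_classTop_of_gauge9TopStep`).
* ★ `pos_of_gauge152OfClassTopStep` ∕ `not_gauge152OfClassTopStep_of_nonpos` — `Gauge152OfClassTopStep F N Sup M B₉ a₀ → 0 < B₉` (`M ≥ 1`, `0 < a₀`).
* ★★ `pos_of_variationalThm1GaugeRegSepTop7M` ∕ `…CoP7M` ∕ `not_…_of_nonpos` ∕ `variationalThm1GaugeRegSepCoP7M_degenerate_of_nonpos` — the v1.1 Thm-1-level sentences `→ 0 < B₃'`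
  (every `Sup`, `M ≥ 1`, `B₃`, `0 < a₀`, `0 < a₁`).  node00-def-K0a's Cut B‴ keyed on `h15G : VariationalThm1GaugeRegSepCoP7M F 2 θ.τ9.M B₃ B₃' a₀ a₁` carries this NECESSARY letter
  (its `hB' : 0 ≤ B₃'` is derivable from `h15G`, as ref-H READ-227 noted for 16d).
WHY ONLY THE CHEAP FLOOR (this lineage's census (β), node00-def-P11 CONCUR l.19952, dag-n07-e RANGE NOTE l.19920): every bond∕pair the guarded sentences read has both endpoints in a cube
`⊆ Ω_n`, `n ≥ 1` — free bonds, no pinned-data plaquette, so FILE 22A's corner engine has no instance; a flat minimiser with `A = 0` meets every clause but `0 < B₃'δ`.  Non-trivial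
print-compatible letters (`B₃' ≳ L²∕434` from a face datum, `B₉ ≳ L·M∕4` from uniform flux — dag-n07-e ERRATUM l.≈20060) are NOT typed here.

HONEST FRAMING: kernel non-vacuity ∕ floor bookkeeping about TREE-typed named facts (`Prop`s with parameters, never asserted); nothing of Bałaban asserted or refuted ([15] p. 279:
«positive constants»); K0⁶ neither discharged nor refuted; N21 NOT discharged; counts unmoved (typed 28∕28 · discharged 5∕28); one finite `𝕋⁴` torus family at fixed `ε = L^{−K}`; not
continuum ∕ OS ∕ mass gap ∕ Clay.  THEOREMS ONLY: no `def`, `instance`, `notation`, `sorry`; standard axioms.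
DEPENDENCES (by name): companion FILE 24B `K0TopIndexWrapGeometry.exists_seq_top ∕ zero_mem_cubeIndices`; FILE 24A `K0ConstantDirectionTower.*`; node00-def-P11 FILE 14 v1.1
`VariationalThm1GaugeRegSepTop7M ∕ …CoP7M ∕ .toTop7M ∕ Sect2.LocalGaugeOn`; dag-n07-e `Gauge9RegSepTopStep ∕ gauge9_of_isMinimizer_classTop_of_gauge9TopStep ∕ Gauge152OfClassTopStep`;
FILE 21A `mem_classTop_of_forall_dist1_lt ∕ coDivSmallOn_of_forall_dist1_le`; FILE 23 `cover_mem_cubeEnl_zero_of_le_one ∕ update_le_one`; FILE 16 `cover_zero_mem_cubeEnl_zero`; FILE 12 `shift_cover`.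
-/

noncomputable section

open scoped Matrix.Norms.L2Operator

namespace Summit.QuantumFields.YangMills.Theorems.K0VariationalThm1GaugeFloors

open Literature.MathematicalPhysics.QuantumFieldTheory.Balaban1983to89
open Literature.MathematicalPhysics.QuantumFieldTheory.Balaban1983to89.Node00
open Literature.MathematicalPhysics.QuantumFieldTheory.Balaban1983to89.T4Continuum
open B15Eq112TorusCover B14DomainGeom B15DeterminingSets BlockAveraging B12RegularSpaces111
open Summit.QuantumFields.YangMills.Theorems.K0BgProvisoOverRange (shift_cover)
open Summit.QuantumFields.YangMills.Theorems.K0VariationalThm1ScaledCorner (cover_zero_mem_cubeEnl_zero)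
open Summit.QuantumFields.YangMills.Theorems.K0TopClassSmallActionMinimiser (mem_classTop_of_forall_dist1_lt coDivSmallOn_of_forall_dist1_le)
open Summit.QuantumFields.YangMills.Theorems.K0VariationalThm1C1Floor (cover_mem_cubeEnl_zero_of_le_one update_le_one)
open Summit.QuantumFields.YangMills.Theorems.K0ConstantDirectionTower
open Summit.QuantumFields.YangMills.Theorems.K0TopIndexWrapGeometry (exists_seq_top zero_mem_cubeIndices)

/-! ## §5  The cheap floors `0 < B₃'` ∕ `0 < B₉` of the NON-WRAPPING (Δ2-guarded) step sentences of dag-n07-e (`Node00/CriticalOnFibreGauge.lean`, p532575) -/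
section Floors

variable {F : T4Family} {N : ℕ} [NeZero N]

/-- At `K := M` the `LM`-cube of step `1` does NOT wrap: `L·M < L^{M+1} ≤ L^{m+M} < 2L^{m+M}` (`M < L^M`, `m ≥ 1`). [cite: Balaban1987RG1, (0.1) p.251, (1.12) p.262 (bookkeeping)] -/
theorem side_one_lt_sitesPerDir (M : ℕ) : ((B14.Eq213MaximalDomains.side (F.P M).L M 1 : ℕ) : ℤ) < (F.P M).sitesPerDir 0 := by
  have hL : 2 ≤ F.L := by have := F.hL11; omega
  have h1 : M < F.L ^ M := Nat.lt_pow_self (by omega)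
  have h2 : F.L ^ (M + 1) ≤ F.L ^ (F.m + M) := Nat.pow_le_pow_right (by omega) (by have := F.hm; omega)
  have h3 : F.L * M < F.L ^ (M + 1) := by rw [pow_succ, mul_comm]; exact Nat.mul_lt_mul_of_pos_right h1 (by omega)
  rw [T4Family.sitesPerDir_eq, B14.Eq213MaximalDomains.side, T4Family.P_L, pow_one]
  push_cast
  have : (F.L * M : ℤ) < F.L ^ (F.m + M) := by exact_mod_cast h3.trans_le h2
  have h4 : (0 : ℤ) ≤ F.L ^ (F.m + M) := by positivity
  linarith

/-- **THE FLAT INSTANCE AT THE TOP INDEX OF LENGTH 1 on `F.P K`** (any `K`, any `M ≥ 1`, any selector): the flat configuration `U₀ ≡ 1` with its own (flat) tower as datum meets every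
antecedent clause of the step sentences at constant thresholds `δ ≡ δ′` (`0 < δ′ ≤ a₁`, `B₃δ′ ≤ ε₀ = a₀`) and is a minimiser over the top-domain class; the `LM`-cube of index `0`
lies in `Ω₁ = T_η` and holds the bond `⟨π(0), e₀⟩`. Packaged as the data the two floors below consume. [cite: Balaban1985Variational, (2),(5),(6),(7) p.278; Balaban1988Convergent, (2.1) p.254, (2.12) p.256 (bookkeeping)] -/
theorem flat_top_instance (Sup : (ν : Stage7Numerics) → (K : ℕ) → (ℕ → Set (Site (F.P K) 0)) → Set (Site (F.P K) 0)) {M : ℕ} (hM : 1 ≤ M)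
    (B₃ : ℝ) {a₀ a₁ : ℝ} (ha₀ : 0 < a₀) (ha₁ : 0 < a₁) (K : ℕ) :
    ∃ (s : SeqOfRecord F numerics7OfRecord₁₂ M (fun _ => (1 : ℝ)) K 1) (δ' : ℝ),
      Sect2.SeqSeparated numerics7OfRecord₁₂.M₁ s ∧ 0 < δ' ∧ δ' ≤ a₁ ∧ B₃ * δ' ≤ a₀ ∧
      Sect2.DataSmall7PTop (avOfRecord F N K) s.Ω (Sup numerics7OfRecord₁₂ K s.Ω) 1 (fun _ => δ') (avgFamily (avOfRecord F N K) 1) ∧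
      (∀ n, n ≤ 1 → PlaqSmallOn (Sect2.omegaPlaqsTop s.Ω (Sup numerics7OfRecord₁₂ K s.Ω) n) (a₀ * (F.P K).eta n ^ 2) (1 : GaugeField (F.P K) 0 (SU N))) ∧
      (∀ n, n ≤ 1 → Sect2.CoDivSmallOn (Sect2.omegaBondsTop s.Ω (Sup numerics7OfRecord₁₂ K s.Ω) n) (a₀ * (F.P K).eta n ^ 3) (1 : GaugeField (F.P K) 0 (SU N))) ∧
      IsMinimizer (avOfRecord F N K)
          {U | (∀ n, n ≤ 1 → PlaqSmallOn (Sect2.omegaPlaqsTop s.Ω (Sup numerics7OfRecord₁₂ K s.Ω) n) (a₀ * (F.P K).eta n ^ 2) U) ∧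
            Sect2.CoDivClassOnTop s.Ω (Sup numerics7OfRecord₁₂ K s.Ω) 1 a₀ U} (genSet s.Ω 1) (avgFamily (avOfRecord F N K) 1) 1 ∧
      (0 : Pt (F.P K).d) ∈ cubeIndices (F.P K) (B14.Eq213MaximalDomains.side (F.P K).L M 1) ∧
      cubeEnl (F.P K) (B14.Eq213MaximalDomains.side (F.P K).L M 1) 0 0 ⊆ s.Ω 1 ∧
      (⟨cover (F.P K) 0, ⟨0, by rw [T4Family.P_d]; norm_num⟩⟩ : PBond (F.P K) 0) ∈
        (Sect2.regionOfSet (F.P K) (cubeEnl (F.P K) (B14.Eq213MaximalDomains.side (F.P K).L M 1) 0 0)).bonds := by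
  classical
  set P : Params := F.P K with hPdef
  have hPd : P.d = 4 := T4Family.P_d F K
  have hd1 : 1 ≤ P.d := by rw [hPd]; norm_num
  have hdpos : (0 : ℝ) < P.d := by rw [hPd]; norm_num
  set μ₀ : Fin P.d := ⟨0, by rw [hPd]; norm_num⟩ with hμ₀
  have hU : ∀ b, (1 : GaugeField P 0 (SU N)) b = if b.dir = μ₀ then (1 : SU N) else 1 := fun b => by simp; rfl
  obtain ⟨s, hΩ, hsep⟩ := exists_seq_top F numerics7OfRecord₁₂ hM (fun _ => (1 : ℝ)) K 1
  -- thresholds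
  obtain ⟨β, hβ⟩ : ∃ β : ℝ, β = max B₃ 1 := ⟨_, rfl⟩
  have hβ1 : 1 ≤ β := by rw [hβ]; exact le_max_right _ _
  have hβpos : 0 < β := by linarith only [hβ1]
  have hβB : B₃ ≤ β := by rw [hβ]; exact le_max_left _ _
  obtain ⟨δ', hδ'⟩ : ∃ δ' : ℝ, δ' = min a₁ (a₀ / β) := ⟨_, rfl⟩
  have hδ'pos : 0 < δ' := by rw [hδ']; exact lt_min ha₁ (by positivity)
  have hδ'a₁ : δ' ≤ a₁ := by rw [hδ']; exact min_le_left _ _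
  have hδ'β : δ' ≤ a₀ / β := by rw [hδ']; exact min_le_right _ _
  have hBδ' : B₃ * δ' ≤ a₀ := by
    calc B₃ * δ' ≤ β * δ' := mul_le_mul_of_nonneg_right hβB hδ'pos.le
      _ ≤ β * (a₀ / β) := mul_le_mul_of_nonneg_left hδ'β hβpos.le
      _ = a₀ := by field_simp
  -- datum rows (every plaquette variable is `1`)
  have h7 : Sect2.DataSmall7PTop (avOfRecord F N K) s.Ω (Sup numerics7OfRecord₁₂ K s.Ω) 1 (fun _ => δ') (avgFamily (avOfRecord F N K) 1) :=
    ⟨fun q _ => by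
      show dist1 (GaugeField.plaqHol (avgFamily (avOfRecord F N K) 1 0) q) < δ'
      rw [dist1_plaqHol_avgFamily_constDir K 1 μ₀ hU 0 q]; exact hδ'pos,
     fun m _ q _ => by
      show dist1 (GaugeField.plaqHol (Sect2.mixedField (avOfRecord F N K) (genSet s.Ω 1 (m + 1))
        (avgFamily (avOfRecord F N K) 1 (m + 1)) (avgFamily (avOfRecord F N K) 1 m)) q) < δ'
      rw [dist1_plaqHol_mixedField_avgFamily_constDir K 1 μ₀ hU]; exact hδ'pos⟩
  -- class clauses for `U₀ ≡ 1`, membership and minimality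
  have hpl0 : ∀ q : Plaq P 0, dist1 (GaugeField.plaqHol (1 : GaugeField P 0 (SU N)) q) = 0 := dist1_plaqHol_constDir 1 μ₀ hU
  have hplaq : ∀ n, n ≤ 1 → PlaqSmallOn (Sect2.omegaPlaqsTop s.Ω (Sup numerics7OfRecord₁₂ K s.Ω) n) (a₀ * P.eta n ^ 2) (1 : GaugeField P 0 (SU N)) :=
    fun n _ q _ => by rw [hpl0]; exact mul_pos ha₀ (pow_pos (by unfold Params.eta; have := P.L_pos; positivity) 2)
  have hcodiv : ∀ n, n ≤ 1 → Sect2.CoDivSmallOn (Sect2.omegaBondsTop s.Ω (Sup numerics7OfRecord₁₂ K s.Ω) n) (a₀ * P.eta n ^ 3) (1 : GaugeField P 0 (SU N)) :=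
    fun n _ => coDivSmallOn_of_forall_dist1_le (1 : GaugeField P 0 (SU N)) le_rfl (fun q => (hpl0 q).le)
      (by rw [mul_zero, mul_zero]; exact mul_pos ha₀ (pow_pos (by unfold Params.eta; have := P.L_pos; positivity) 3)) _
  obtain ⟨r, hr⟩ : ∃ r : ℝ, r = a₀ * P.eta 1 ^ 3 / (4 * P.d) := ⟨_, rfl⟩
  have hηpos : 0 < P.eta 1 := by unfold Params.eta; have := P.L_pos; positivity
  have hrpos : 0 < r := by rw [hr]; positivity
  have hrη : (P.d : ℝ) * (2 * r) < a₀ * P.eta 1 ^ 3 := by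
    rw [hr]
    have hpos : 0 < a₀ * P.eta 1 ^ 3 := by positivity
    have heq : (P.d : ℝ) * (2 * (a₀ * P.eta 1 ^ 3 / (4 * P.d))) = a₀ * P.eta 1 ^ 3 / 2 := by
      field_simp; ring
    rw [heq]; linarith only [hpos]
  have hclass := mem_classTop_of_forall_dist1_lt (N := N) hd1 s.Ω (Sup numerics7OfRecord₁₂ K s.Ω) 1 hrpos.le hrη (U := (1 : GaugeField P 0 (SU N)))
    (fun q => by rw [hpl0]; exact hrpos)
  have hA : AgreeOn (genSet s.Ω 1) (avgFamily (avOfRecord F N K) 1) (avgFamily (avOfRecord F N K) 1) := fun _ _ _ => rfl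
  have hmin : IsMinimizer (avOfRecord F N K)
      {U | (∀ n, n ≤ 1 → PlaqSmallOn (Sect2.omegaPlaqsTop s.Ω (Sup numerics7OfRecord₁₂ K s.Ω) n) (a₀ * P.eta n ^ 2) U) ∧
        Sect2.CoDivClassOnTop s.Ω (Sup numerics7OfRecord₁₂ K s.Ω) 1 a₀ U} (genSet s.Ω 1) (avgFamily (avOfRecord F N K) 1) 1 :=
    ⟨hclass, hA, fun U _ _ => (wilsonAction4_constDir_le 1 μ₀ hU).trans (wilsonAction4_nonneg U)⟩
  -- the `LM`-cube of index `0` and its bond `⟨π(0), e₀⟩`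
  have hL : 2 ≤ F.L := by have := F.hL11; omega
  have hsideL : B14.Eq213MaximalDomains.side P.L M 1 = F.L * M := by rw [B14.Eq213MaximalDomains.side, T4Family.P_L, pow_one]
  have hside2 : 2 ≤ B14.Eq213MaximalDomains.side P.L M 1 := by rw [hsideL]; nlinarith
  have hside1 : 1 ≤ B14.Eq213MaximalDomains.side P.L M 1 := le_trans (by norm_num) hside2
  have h0 : ∀ i, 0 ≤ (0 : Pt P.d) i ∧ (0 : Pt P.d) i ≤ 1 := fun i => by simp
  refine ⟨s, δ', hsep, hδ'pos, hδ'a₁, hBδ', h7, hplaq, hcodiv, hmin, zero_mem_cubeIndices hside1, ?_, ?_, ?_⟩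
  · rw [hΩ 1 le_rfl le_rfl]; exact Set.subset_univ _
  · exact cover_zero_mem_cubeEnl_zero hside1
  · show (cover P 0).shift μ₀ ∈ _
    rw [shift_cover]
    exact cover_mem_cubeEnl_zero_of_le_one hside2 (update_le_one h0 rfl)

/-- **★ THE CHEAP FLOOR OF dag-n07-e's STEP SENTENCE: `Gauge9RegSepTopStep F N Sup M B₃ B₃' a₀ a₁ → 0 < B₃'`** (every `Sup`, every `M ≥ 1`, every `B₃`, `0 < a₀`, `0 < a₁`, every `N ≥ 1`): at the flat
instance on `F.P M` (where the `LM`-cube of step `1` does not wrap, `side_one_lt_sitesPerDir`) the sentence hands over `A` with `0 ≤ ‖A(⟨π(0), e₀⟩)‖ < B₃'δ′`, `δ′ > 0`.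
No pinned-data plaquette lies inside an `⊆ Ω_n` cube, so no (8)-type floor transfers (dag-n07-e RANGE NOTE, INBOX l.19920; this lineage's census (β)).
[cite: Balaban1985Variational, Thm 1 (9) p.279; Balaban1987RG1, (1.12) p.262 (bookkeeping)] -/
theorem pos_of_gauge9RegSepTopStep {Sup : (ν : Stage7Numerics) → (K : ℕ) → (ℕ → Set (Site (F.P K) 0)) → Set (Site (F.P K) 0)} {M : ℕ} (hM : 1 ≤ M)
    {B₃ B₃' a₀ a₁ : ℝ} (ha₀ : 0 < a₀) (ha₁ : 0 < a₁) (h9 : Gauge9RegSepTopStep F N Sup M B₃ B₃' a₀ a₁) : 0 < B₃' := by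
  obtain ⟨s, δ', hsep, hδ'pos, hδ'a₁, hBδ', h7, -, -, hmin, ha, hΩ, hb⟩ := flat_top_instance (F := F) (N := N) Sup hM B₃ ha₀ ha₁ M
  obtain ⟨u, A, -, hA, -⟩ := gauge9_of_isMinimizer_classTop_of_gauge9TopStep h9 numerics7OfRecord₁₂ (fun _ => (1 : ℝ)) M 1 s hsep
    (by change (0 : ℕ) < 1; exact Nat.one_pos) le_rfl a₀ (fun _ => δ') (fun _ _ => ⟨hδ'pos, hδ'a₁, hBδ'⟩)
    (fun _ _ => by linarith only [hδ'pos]) (fun _ _ => by linarith only [hδ'pos]) le_rfl _ h7 hmin le_rfl le_rfl (Or.inl rfl)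
    (side_one_lt_sitesPerDir (F := F) M) ha hΩ
  have h := hA _ hb
  have h0 : (0 : ℝ) ≤ ‖A ⟨cover (F.P M) 0, ⟨0, by rw [T4Family.P_d]; norm_num⟩⟩‖ := norm_nonneg _
  by_contra hB
  rw [not_lt] at hB
  have : B₃' * δ' ≤ 0 := mul_nonpos_of_nonpos_of_nonneg hB hδ'pos.le
  linarith

/-- Hence `¬ Gauge9RegSepTopStep F N Sup M B₃ B₃' a₀ a₁` for `B₃' ≤ 0` (`M ≥ 1`, `0 < a₀`, `0 < a₁`). [cite: Balaban1985Variational, Thm 1 (9) p.279 (bookkeeping)] -/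
theorem not_gauge9RegSepTopStep_of_nonpos {Sup : (ν : Stage7Numerics) → (K : ℕ) → (ℕ → Set (Site (F.P K) 0)) → Set (Site (F.P K) 0)} {M : ℕ} (hM : 1 ≤ M)
    {B₃ B₃' a₀ a₁ : ℝ} (ha₀ : 0 < a₀) (ha₁ : 0 < a₁) (hB : B₃' ≤ 0) : ¬ Gauge9RegSepTopStep F N Sup M B₃ B₃' a₀ a₁ :=
  fun h => absurd (pos_of_gauge9RegSepTopStep hM ha₀ ha₁ h) (not_lt.mpr hB)

/-- **★ THE CHEAP FLOOR OF dag-n07-e's GAUGE-FIXING SENTENCE: `Gauge152OfClassTopStep F N Sup M B₉ a₀ → 0 < B₉`** (every `Sup`, every `M ≥ 1`, `0 < a₀`, every `N ≥ 1`): the flat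
configuration is in the class (2)∕(6)-Top at thresholds `ε ≡ a₀` (plaquettes `0 < a₀η_m²`, co-divergence `0 < a₀η_m³`), and at `F.P M` the `LM`-cube of step `1` does not wrap, so the
sentence hands over `A` with `0 ≤ ‖A(⟨π(0), e₀⟩)‖ < B₉·a₀`. [cite: Balaban1985Variational, (152) p.301; Balaban1985RegularSpaces, Thm 2 pp.82–83 (bookkeeping)] -/
theorem pos_of_gauge152OfClassTopStep {Sup : (ν : Stage7Numerics) → (K : ℕ) → (ℕ → Set (Site (F.P K) 0)) → Set (Site (F.P K) 0)} {M : ℕ} (hM : 1 ≤ M)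
    {B₉ a₀ : ℝ} (ha₀ : 0 < a₀) (h : Gauge152OfClassTopStep F N Sup M B₉ a₀) : 0 < B₉ := by
  obtain ⟨s, δ', hsep, -, -, -, -, hplaq, hcodiv, -, ha, hΩ, hb⟩ := flat_top_instance (F := F) (N := N) Sup hM 0 ha₀ ha₀ M
  obtain ⟨u, A, -, hA, -⟩ := h numerics7OfRecord₁₂ (fun _ => (1 : ℝ)) M 1 s hsep (by change (0 : ℕ) < 1; exact Nat.one_pos) le_rfl (fun _ => a₀)
    (fun _ _ => ⟨ha₀, le_rfl⟩) (fun _ _ => by linarith only [ha₀]) (fun _ _ => by linarith only [ha₀]) 1 hplaq hcodiv 1 le_rfl le_rfl _ (Or.inl rfl)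
    (side_one_lt_sitesPerDir (F := F) M) 0 ha hΩ
  have h1 := hA _ hb
  have h0 : (0 : ℝ) ≤ ‖A ⟨cover (F.P M) 0, ⟨0, by rw [T4Family.P_d]; norm_num⟩⟩‖ := norm_nonneg _
  by_contra hB
  rw [not_lt] at hB
  have : B₉ * a₀ ≤ 0 := mul_nonpos_of_nonpos_of_nonneg hB ha₀.le
  linarith

/-- Hence `¬ Gauge152OfClassTopStep F N Sup M B₉ a₀` for `B₉ ≤ 0` (`M ≥ 1`, `0 < a₀`). [cite: Balaban1985Variational, (152) p.301 (bookkeeping)] -/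
theorem not_gauge152OfClassTopStep_of_nonpos {Sup : (ν : Stage7Numerics) → (K : ℕ) → (ℕ → Set (Site (F.P K) 0)) → Set (Site (F.P K) 0)} {M : ℕ} (hM : 1 ≤ M)
    {B₉ a₀ : ℝ} (ha₀ : 0 < a₀) (hB : B₉ ≤ 0) : ¬ Gauge152OfClassTopStep F N Sup M B₉ a₀ :=
  fun h => absurd (pos_of_gauge152OfClassTopStep hM ha₀ h) (not_lt.mpr hB)

end Floors

/-! ## §6  The cheap floor `0 < B₃'` of node00-def-P11's GUARDED (v1.1) Thm-1-level sentences `VariationalThm1GaugeRegSep{Top7M,CoP7M}` (p534358) -/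
section FloorsV11

variable {F : T4Family} {N : ℕ} [NeZero N]

/-- **★★ THE CHEAP FLOOR OF THE GUARDED ∃-GAUGE SENTENCE OF [15] THM 1: `VariationalThm1GaugeRegSepTop7M F N Sup M B₃ B₃' a₀ a₁ → 0 < B₃'`** (FILE 14 v1.1 p534358, every `Sup`,
every `M ≥ 1`, every `B₃`, `0 < a₀`, `0 < a₁`, every `N ≥ 1`) — node00-def-P11's «expected floor» made kernel: the flat instance on `F.P M` (TOP index of length 1, the non-wrapping
`LM`-cube of index `0`, flat minimiser, flat tower as datum) and `0 ≤ ‖A(⟨π(0), e₀⟩)‖ < B₃'δ′`.  node00-def-K0a's Cut B‴ keyed on `h15G` carries this NECESSARY letter (its `hB' : 0 ≤ B₃'`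
is derivable).  The tightness of the sentence's non-wrapping premise is §4. [cite: Balaban1985Variational, Thm 1 (9) p.279; Balaban1988Convergent, (2.12) p.256 (bookkeeping)] -/
theorem pos_of_variationalThm1GaugeRegSepTop7M {Sup : (ν : Stage7Numerics) → (K : ℕ) → (ℕ → Set (Site (F.P K) 0)) → Set (Site (F.P K) 0)} {M : ℕ} (hM : 1 ≤ M)
    {B₃ B₃' a₀ a₁ : ℝ} (ha₀ : 0 < a₀) (ha₁ : 0 < a₁) (h : VariationalThm1GaugeRegSepTop7M F N Sup M B₃ B₃' a₀ a₁) : 0 < B₃' := by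
  obtain ⟨s, δ', hsep, hδ'pos, hδ'a₁, hBδ', h7, -, -, hmin, ha, hΩ, hb⟩ := flat_top_instance (F := F) (N := N) Sup hM B₃ ha₀ ha₁ M
  obtain ⟨u, A, -, hA, -⟩ := (h numerics7OfRecord₁₂ (fun _ => (1 : ℝ)) M 1 s hsep (by change (0 : ℕ) < 1; exact Nat.one_pos) a₀ (fun _ => δ')
    (fun _ _ => ⟨hδ'pos, hδ'a₁, hBδ'⟩) (fun _ _ => by linarith only [hδ'pos]) (fun _ _ => by linarith only [hδ'pos]) le_rfl _ h7 1 hmin 1 le_rfl le_rfl).1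
    (side_one_lt_sitesPerDir (F := F) M) 0 ha hΩ
  have h1 := hA _ hb
  have h0 : (0 : ℝ) ≤ ‖A ⟨cover (F.P M) 0, ⟨0, by rw [T4Family.P_d]; norm_num⟩⟩‖ := norm_nonneg _
  by_contra hB
  rw [not_lt] at hB
  have : B₃' * δ' ≤ 0 := mul_nonpos_of_nonpos_of_nonneg hB hδ'pos.le
  linarith

/-- Hence `¬ VariationalThm1GaugeRegSepTop7M F N Sup M B₃ B₃' a₀ a₁` for every `B₃' ≤ 0` (`M ≥ 1`, `0 < a₀`, `0 < a₁`). [cite: Balaban1985Variational, Thm 1 (9) p.279 (bookkeeping)] -/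
theorem not_variationalThm1GaugeRegSepTop7M_of_nonpos {Sup : (ν : Stage7Numerics) → (K : ℕ) → (ℕ → Set (Site (F.P K) 0)) → Set (Site (F.P K) 0)} {M : ℕ} (hM : 1 ≤ M)
    {B₃ B₃' a₀ a₁ : ℝ} (ha₀ : 0 < a₀) (ha₁ : 0 < a₁) (hB : B₃' ≤ 0) : ¬ VariationalThm1GaugeRegSepTop7M F N Sup M B₃ B₃' a₀ a₁ :=
  fun h => absurd (pos_of_variationalThm1GaugeRegSepTop7M hM ha₀ ha₁ h) (not_lt.mpr hB)

/-- **★★ THE CHEAP FLOOR OF THE GUARDED `CoP` SENTENCE: `VariationalThm1GaugeRegSepCoP7M F N M B₃ B₃' a₀ a₁ → 0 < B₃'`** (v1.1; the selector of record `suppDomOfRecord`, `.toTop7M`).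
[cite: Balaban1985Variational, Thm 1 (9) p.279; Balaban1988Convergent, (2.12) p.256 (bookkeeping)] -/
theorem pos_of_variationalThm1GaugeRegSepCoP7M {M : ℕ} (hM : 1 ≤ M) {B₃ B₃' a₀ a₁ : ℝ} (ha₀ : 0 < a₀) (ha₁ : 0 < a₁)
    (h : VariationalThm1GaugeRegSepCoP7M F N M B₃ B₃' a₀ a₁) : 0 < B₃' :=
  pos_of_variationalThm1GaugeRegSepTop7M hM ha₀ ha₁ h.toTop7M

/-- Hence `¬ VariationalThm1GaugeRegSepCoP7M F N M B₃ B₃' a₀ a₁` for every `B₃' ≤ 0` (`M ≥ 1`, `0 < a₀`, `0 < a₁`). [cite: Balaban1985Variational, Thm 1 (9) p.279 (bookkeeping)] -/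
theorem not_variationalThm1GaugeRegSepCoP7M_of_nonpos {M : ℕ} (hM : 1 ≤ M) {B₃ B₃' a₀ a₁ : ℝ} (ha₀ : 0 < a₀) (ha₁ : 0 < a₁) (hB : B₃' ≤ 0) :
    ¬ VariationalThm1GaugeRegSepCoP7M F N M B₃ B₃' a₀ a₁ :=
  fun h => absurd (pos_of_variationalThm1GaugeRegSepCoP7M hM ha₀ ha₁ h) (not_lt.mpr hB)

/-- Truth set of the guarded `CoP` sentence at a non-positive gauge constant: only the degenerate corner `a₀ ≤ 0 ∨ a₁ ≤ 0` (`M ≥ 1`). [cite: Balaban1985Variational, Thm 1 (9) p.279 (bookkeeping)] -/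
theorem variationalThm1GaugeRegSepCoP7M_degenerate_of_nonpos {M : ℕ} (hM : 1 ≤ M) {B₃ B₃' a₀ a₁ : ℝ} (hB : B₃' ≤ 0)
    (h : VariationalThm1GaugeRegSepCoP7M F N M B₃ B₃' a₀ a₁) : a₀ ≤ 0 ∨ a₁ ≤ 0 := by
  by_contra hne
  push Not at hne
  exact not_variationalThm1GaugeRegSepCoP7M_of_nonpos hM hne.1 hne.2 hB h

end FloorsV11

end Summit.QuantumFields.YangMills.Theorems.K0VariationalThm1GaugeFloors

end
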